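import Mathlib
import Summits.Ventures.HodgeRepro.Tier4.Line4.TailGlue
import Summits.Ventures.HodgeRepro.Tier4.Line4.LevelIndexBound
import Summits.Ventures.HodgeRepro.Tier4.Line4.LevelPrime
import Summits.Ventures.HodgeRepro.Tier4.Line4.MainTermNormForm

/-!
# Tier4/Line4/TailGlueMain — C-L4-TAIL-GLUE-2: the (7b) glue with (S-IDX) discharged by name

Blind re-derivation cell `pub-hodge-repro`, Tier 4 «prove the step» (README §9–§10), LINE L4, seat t4-x2 (g5, reserve
wall-breaker; plan-4 g5's GO S15485 on my S15483).  Tree path `lean/Summits/Ventures/HodgeRepro/Tier4/Line4/TailGlueMain.lean`.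
Imports `Line4/TailGlue` (p707793), `Line4/LevelIndexBound` (L4-p2 p707287: `levelDoubleCoset_measure_le_of_natSize_lt_one`),
`Line4/LevelPrime` (L1-p1 p707278: `exists_levelPrime`'s integrality clause is the hypothesis shape), `Line4/MainTermNormForm`
(L4-p1: `main_term_of_displays''`, the norm-form (S-MAIN)).  Mathlib-level; no literature; no `def`.

WHAT.  The glue `exists_levelFamily_fibreDominated_of_displays` (TailGlue) binds the double-coset INDEX BOUND (S-IDX) as a
hypothesis on the witness sets `levelDoubleCosetSet W γ₀ N` / `levelKSet W N`.  L4-p2's `levelDoubleCoset_measure_le_of_natSize_lt_one`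
proves it for EVERY Haar `μ₀` of `G(𝔸_f)` and every prime `p` at whose places `γ₀` and `γ₀⁻¹` are integral — the clause
`exists_levelPrime` exhibits a prime for.  The bridge typed here: the witness sets are L4-p2's sets at the FINITE PART
`γ₀,f = ofFinPart γ₀` (definitional), and the integrality of `GA.mat (ofFinPart γ₀)` at a finite place is that of
`GA.mat γ₀` (`GA.mat_ofFinPart`, `finM_mixM`, `ofFinPart_inv`).

* `finPart_mat_ofFinPart` — `finPart k (GA.mat W (ofFinPart γ₀) i j) v = finPart k (GA.mat W γ₀ i j) v` (and for `γ₀⁻¹`).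
* **`hidx_of_natSize_lt_one`** — (S-IDX) along `p ^ (n + n₁)` from `p.Prime` and `exists_levelPrime`'s clause at `γ₀`.
* **`exists_levelFamily_fibreDominated_of_displays_idx`** — the glue with (S-IDX) replaced by `hp : p.Prime` and that clause.
* **`exists_levelFamily_fibreDominated_of_displays_main`** — the same with (S-MAIN) discharged BY NAME through L4-p1's
  `main_term_of_displays''` (MainTermNormForm): the inputs are the chain's Haar normalisations (`hcμ`, `hcμ'`, `hcμ₀`, all
  constants `> 0`), `hreg : IsRegularRational W γ₀`, `hDZf`, `hfd`, the archimedean non-vanishing `harch`, the NORM-FORM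
  finite non-vanishing (S-FIN-NV) `hnv` (plan-4 S15484: the display of record for (S-MAIN), never the pointwise `hδ`), and
  the chain's integrability inputs `hchain : ∀ N, ChainInputs …`.  So (7b) is a THEOREM modulo (S-SEP) (S-RATIO) (S-UNIT)
  (S-COUNT) (S-SPARSE) + `harch` + (S-FIN-NV) + `ChainInputs`.

Nothing here says anything about the status of the Hodge conjecture for CM abelian varieties, which is NOT proved
(HC_CM is NOT proved by anyone in this repository).
-/

set_option autoImplicit false

noncomputable section

namespace Summit.Ventures.HodgeRepro.Tier4.Line4

open MeasureTheory Topology Filter NumberField IsDedekindDomain Summit.Ventures.HodgeRepro.Tier4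
  Summit.Ventures.HodgeRepro.Tier4.Common Summit.Ventures.HodgeRepro.Tier4.Line1
  Summit.Ventures.HodgeRepro.Tier4.Line1.RTF Summit.Ventures.HodgeRepro.Tier4.Line4.L1Class

open scoped NumberField NNReal

section Idx

variable {k : Type} [Field k] [NumberField k] (W : PlaneData k)

/-- The finite-adelic entries of `GA.mat (ofFinPart γ₀)` are those of `GA.mat γ₀`. -/
theorem finPart_mat_ofFinPart (γ₀ : GA W) (i j : Fin 4) :
    finPart k (GA.mat W (GA.ofFinPart W γ₀) i j) = finPart k (GA.mat W γ₀ i j) := by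
  have h := congrFun (congrFun (finM_mixM (k := k) 1 (finM k (GA.mat W γ₀))) i) j
  simp only [finM, Matrix.map_apply] at h
  rw [GA.mat_ofFinPart]
  exact h

variable [MeasurableSpace (GA W)] [BorelSpace (GA W)]

/-- **(S-IDX) BY NAME**: for a prime `p` at whose places `γ₀` and `γ₀⁻¹` are integral (`exists_levelPrime`'s clause), the
double-coset index bound along `p ^ (n + n₁)` for every Haar measure `μ₀` of `G(𝔸_f)` — the `hidx` binder of the glue. -/
theorem hidx_of_natSize_lt_one (μ₀ : Measure (finitePart W)) [μ₀.IsHaarMeasure] (γ₀ : GA W) (p : ℕ) (hp : p.Prime)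
    (hγ₀ : ∀ v : HeightOneSpectrum (𝓞 k), natSize k v p < 1 → ∀ i j : Fin 4,
      Valued.v (finPart k (GA.mat W γ₀ i j) v) ≤ 1 ∧ Valued.v (finPart k (GA.mat W γ₀⁻¹ i j) v) ≤ 1)
    (n₁ : ℕ) :
    ∃ M₁ : ℝ, ∀ n : ℕ, (μ₀ (levelDoubleCosetSet W γ₀ (p ^ (n + n₁)))).toReal ≤
      M₁ * (μ₀ (levelKSet W (p ^ (n + n₁)))).toReal := by
  have hγ₀' : ∀ v : HeightOneSpectrum (𝓞 k), natSize k v p < 1 → ∀ i j : Fin 4,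
      Valued.v (finPart k (GA.mat W (GA.ofFinPart W γ₀) i j) v) ≤ 1 ∧
        Valued.v (finPart k (GA.mat W (GA.ofFinPart W γ₀)⁻¹ i j) v) ≤ 1 := by
    intro v hv i j
    rw [finPart_mat_ofFinPart, ← ofFinPart_inv, finPart_mat_ofFinPart]
    exact hγ₀ v hv i j
  obtain ⟨M₁, -, hM₁⟩ := levelDoubleCoset_measure_le_of_natSize_lt_one W μ₀ (ofFinPart_mem_finitePart W γ₀) p hp hγ₀'
  exact ⟨M₁, fun n => hM₁ (n + n₁)⟩

end Idx

section Glue2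

variable {k : Type} [Field k] [NumberField k] (W : PlaneData k) [MeasurableSpace (GA W)] [BorelSpace (GA W)]
  (R : RTFData W) (μ : Measure (GA W)) [μ.IsHaarMeasure] [R.μT.IsHaarMeasure] [R.μT'.IsHaarMeasure]
  (DG : Set (GA W)) (fdG : IsFundamentalDomain (rationalPoints W) DG μ) (compG : IsCompact (closure DG))
  (compT : IsCompact (closure R.DT)) (compT' : IsCompact (closure R.DT'))

/-- **THE (7b) GLUE WITH (S-IDX) BY NAME**: `exists_levelFamily_fibreDominated_of_displays` with the index bound replaced by
`hp : p.Prime` and the integrality of `γ₀`, `γ₀⁻¹` at the places above `p` (`exists_levelPrime` exhibits such a `p`). -/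
theorem exists_levelFamily_fibreDominated_of_displays_idx (hRH : R.IsHaar)
    (hc : Continuous R.chi) (hu : ∀ a, ‖R.chi a‖ = 1) (hc' : Continuous R.chi') (hu' : ∀ a, ‖R.chi' a‖ = 1)
    (q : QuadData k) (g g' : Matrix (Fin 4) (Fin 4) k) (w₀ : InfinitePlace k) (eP eM eP' eM' : InfinitePlace k → ℤ)
    (γ₀ : (Setting.ofAdelicData W R μ DG fdG compG compT compT').Gk)
    (νinf : Measure (torusInf W)) (νinf' : Measure (torusInf' W)) (finf : GA W → ℂ)
    (hfinf : IsArchCoeffD W (Setting.ofAdelicData W R μ DG fdG compG compT compT') R q g g' w₀ eP eM eP' eM'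
      (γ₀ : GA W) νinf νinf' finf)
    (μ₀ : Measure (finitePart W)) [μ₀.IsHaarMeasure] {e : GA W → ℂ} (he : IsInfFactor W e)
    (hequiv : ∀ (w : InfinitePlace k) (κ : GA W), κ ∈ localTorusAt' W w → ∀ x,
      e (x * κ) = weightAt' W q w g g' 0 κ ^ (-eP' w) * weightAt' W q w g g' 1 κ ^ (-eM' w) * e x)
    (p n₁ : ℕ) (hp : p.Prime)
    (hγ₀ : ∀ v : HeightOneSpectrum (𝓞 k), natSize k v p < 1 → ∀ i j : Fin 4,
      Valued.v (finPart k (GA.mat W (γ₀ : GA W) i j) v) ≤ 1 ∧ Valued.v (finPart k (GA.mat W (γ₀ : GA W)⁻¹ i j) v) ≤ 1)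
    (hsep : ∀ n ≥ n₁, ∀ γ : rationalPoints W,
      (torusT W).map (MulAut.conj ((γ : GA W))⁻¹).toMonoidHom = torusT' W →
      ∀ t ∈ torusT W, ∀ t' ∈ torusT' W,
        GA.ofFinPart W (t⁻¹ * (γ : GA W) * t') ∉ levelDoubleCoset W (p ^ n) (GA.ofFinPart W (γ₀ : GA W)))
    (νf : Measure (torusFin W)) (νf' : Measure (torusFin' W)) (DZf : Set (torusFin W)) (C' : ℝ) (hC' : 0 < C')
    (hratio : ∀ (N : ℕ) (γ : rationalPoints W),
      ¬ ((torusT W).map (MulAut.conj ((γ : GA W))⁻¹).toMonoidHom = torusT' W) →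
      (suppMeasureFolded W R (γ₀ : GA W) (p ^ (N + n₁)) (γ : GA W)).toReal ≤
        C' * (suppMeasure W νf νf' (γ₀ : GA W) DZf (p ^ (N + n₁)) (γ₀ : GA W)).toReal)
    (hv : ∀ N : ℕ, 0 < (suppMeasure W νf νf' (γ₀ : GA W) DZf (p ^ (N + n₁)) (γ₀ : GA W)).toReal)
    (hcount : SublevelCount₀ W (Setting.ofAdelicData W R μ DG fdG compG compT compT'))
    (gth : ℕ → ℝ) (hg : Tendsto gth atTop atTop)
    (hR : ∀ (N : ℕ) (γ : (Setting.ofAdelicData W R μ DG fdG compG compT compT').Gk),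
      (Setting.ofAdelicData W R μ DG fdG compG compT compT').orbitOf γ ∉
        ({(Setting.ofAdelicData W R μ DG fdG compG compT compT').orbitOf γ₀} :
          Finset (Setting.ofAdelicData W R μ DG fdG compG compT compT').Orbit) →
      (∃ t ∈ R.DT, ∃ t' ∈ R.DT',
        (Setting.ofAdelicData W R μ DG fdG compG compT compT').conv
          (prodFn W finf (ffinMuNat W μ₀ (γ₀ : GA W) (fun n => p ^ (n + n₁)) (p ^ (N + n₁))))
          (testNat W e (p ^ (N + n₁))) ((t : GA W)⁻¹ * γ * (t' : GA W)) ≠ 0) →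
      gth N ≤ archDist W (γ : GA W))
    (hmain : ∃ m : ℝ, 0 < m ∧ ∃ N₁ : ℕ, ∀ N ≥ N₁,
      m * (C' * (suppMeasure W νf νf' (γ₀ : GA W) DZf (p ^ (N + n₁)) (γ₀ : GA W)).toReal) ≤
        ‖(Setting.ofAdelicData W R μ DG fdG compG compT compT').orbital R.chi R.chi'
          ((Setting.ofAdelicData W R μ DG fdG compG compT compT').orbitOf γ₀)
          ((Setting.ofAdelicData W R μ DG fdG compG compT compT').conv
            (prodFn W finf (ffinMuNat W μ₀ (γ₀ : GA W) (fun n => p ^ (n + n₁)) (p ^ (N + n₁))))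
            (testNat W e (p ^ (N + n₁))))‖) :
    ∃ lev : ℕ → ℕ, (∀ n, lev n ≠ 0) ∧
    ∃ ffin f₂ : ℕ → GA W → ℂ, TailFamily' W q g g' eP' eM' (γ₀ : GA W) ffin f₂ ∧
      ∃ E : Finset (Setting.ofAdelicData W R μ DG fdG compG compT compT').Orbit,
        (Setting.ofAdelicData W R μ DG fdG compG compT compT').orbitOf γ₀ ∈ E ∧
        FibreDominatedFrom (Setting.ofAdelicData W R μ DG fdG compG compT compT') R.chi R.chi' E
          (fun n => (Setting.ofAdelicData W R μ DG fdG compG compT compT').conv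
            (prodFn W finf (ffin (lev n))) (f₂ (lev n))) :=
  exists_levelFamily_fibreDominated_of_displays W R μ DG fdG compG compT compT' hRH hc hu hc' hu' q g g' w₀ eP eM eP' eM'
    γ₀ νinf νinf' finf hfinf μ₀ he hequiv p n₁ hp.ne_zero (hidx_of_natSize_lt_one W μ₀ (γ₀ : GA W) p hp hγ₀ n₁) hsep
    νf νf' DZf C' hC' hratio hv hcount gth hg hR hmain

/-- **THE (7b) GLUE WITH (S-IDX) AND (S-MAIN) BY NAME**: `exists_levelFamily_fibreDominated_of_displays_idx` with the main
term discharged through `main_term_of_displays''` — the remaining hypotheses are (S-SEP), (S-RATIO), (S-UNIT), (S-COUNT),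
(S-SPARSE), the archimedean non-vanishing `harch`, the norm-form finite non-vanishing (S-FIN-NV) `hnv`, and the chain's
integrability inputs `hchain`. -/
theorem exists_levelFamily_fibreDominated_of_displays_main [MeasurableMul (torusT W)] [MeasurableMul (torusT' W)]
    (hRH : R.IsHaar)
    (hc : Continuous R.chi) (hu : ∀ a, ‖R.chi a‖ = 1) (hc' : Continuous R.chi') (hu' : ∀ a, ‖R.chi' a‖ = 1)
    (q : QuadData k) (g g' : Matrix (Fin 4) (Fin 4) k) (w₀ : InfinitePlace k) (eP eM eP' eM' : InfinitePlace k → ℤ)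
    (γ₀ : rationalPoints W) (hreg : IsRegularRational W γ₀)
    (νinf : Measure (torusInf W)) [νinf.IsHaarMeasure] (νf : Measure (torusFin W)) [νf.IsHaarMeasure]
    (c : ℝ≥0) (hc0 : 0 < c) (hcμ : R.μT = c • Measure.map (torusSplit W).symm (νinf.prod νf))
    (νinf' : Measure (torusInf' W)) [νinf'.IsHaarMeasure] (νf' : Measure (torusFin' W)) [νf'.IsHaarMeasure]
    (c' : ℝ≥0) (hc0' : 0 < c') (hcμ' : R.μT' = c' • Measure.map (torusSplit' W).symm (νinf'.prod νf'))
    (DZf : Set (torusFin W)) (hDZf : MeasurableSet DZf) (hfd : IsFundamentalDomain (centreFin W) DZf νf)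
    (μinf : Measure (infinitePart W)) [μinf.IsHaarMeasure] (μ₀ : Measure (finitePart W)) [μ₀.IsHaarMeasure]
    (c₀ : ℝ≥0) (hc₀ : 0 < c₀) (hcμ₀ : μ = c₀ • Measure.map (gaSplit W).symm (μinf.prod μ₀))
    (finf : GA W → ℂ)
    (hfinf : IsArchCoeffD W (Setting.ofAdelicData W R μ DG fdG compG compT compT') R q g g' w₀ eP eM eP' eM'
      (γ₀ : GA W) νinf νinf' finf)
    {e : GA W → ℂ} (he : IsInfFactor W e)
    (hequiv : ∀ (w : InfinitePlace k) (κ : GA W), κ ∈ localTorusAt' W w → ∀ x,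
      e (x * κ) = weightAt' W q w g g' 0 κ ^ (-eP' w) * weightAt' W q w g g' 1 κ ^ (-eM' w) * e x)
    (harch : L1Class.archFactor W R (convInf W μinf finf e) (γ₀ : GA W) νinf νinf' ≠ 0)
    (p n₁ : ℕ) (hp : p.Prime)
    (hγ₀ : ∀ v : HeightOneSpectrum (𝓞 k), natSize k v p < 1 → ∀ i j : Fin 4,
      Valued.v (finPart k (GA.mat W (γ₀ : GA W) i j) v) ≤ 1 ∧ Valued.v (finPart k (GA.mat W (γ₀ : GA W)⁻¹ i j) v) ≤ 1)
    (hsep : ∀ n ≥ n₁, ∀ γ : rationalPoints W,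
      (torusT W).map (MulAut.conj ((γ : GA W))⁻¹).toMonoidHom = torusT' W →
      ∀ t ∈ torusT W, ∀ t' ∈ torusT' W,
        GA.ofFinPart W (t⁻¹ * (γ : GA W) * t') ∉ levelDoubleCoset W (p ^ n) (GA.ofFinPart W (γ₀ : GA W)))
    (C' : ℝ) (hC' : 0 < C')
    (hratio : ∀ (N : ℕ) (γ : rationalPoints W),
      ¬ ((torusT W).map (MulAut.conj ((γ : GA W))⁻¹).toMonoidHom = torusT' W) →
      (suppMeasureFolded W R (γ₀ : GA W) (p ^ (N + n₁)) (γ : GA W)).toReal ≤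
        C' * (suppMeasure W νf νf' (γ₀ : GA W) DZf (p ^ (N + n₁)) (γ₀ : GA W)).toReal)
    (hv : ∀ N : ℕ, 0 < (suppMeasure W νf νf' (γ₀ : GA W) DZf (p ^ (N + n₁)) (γ₀ : GA W)).toReal)
    (hcount : SublevelCount₀ W (Setting.ofAdelicData W R μ DG fdG compG compT compT'))
    (gth : ℕ → ℝ) (hg : Tendsto gth atTop atTop)
    (hR : ∀ (N : ℕ) (γ : (Setting.ofAdelicData W R μ DG fdG compG compT compT').Gk),
      (Setting.ofAdelicData W R μ DG fdG compG compT compT').orbitOf γ ∉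
        ({(Setting.ofAdelicData W R μ DG fdG compG compT compT').orbitOf γ₀} :
          Finset (Setting.ofAdelicData W R μ DG fdG compG compT compT').Orbit) →
      (∃ t ∈ R.DT, ∃ t' ∈ R.DT',
        (Setting.ofAdelicData W R μ DG fdG compG compT compT').conv
          (prodFn W finf (ffinMuNat W μ₀ (γ₀ : GA W) (fun n => p ^ (n + n₁)) (p ^ (N + n₁))))
          (testNat W e (p ^ (N + n₁))) ((t : GA W)⁻¹ * γ * (t' : GA W)) ≠ 0) →
      gth N ≤ archDist W (γ : GA W))
    -- (S-FIN-NV)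
    (hnv : ∃ δ : ℝ, 0 < δ ∧ ∃ N₀ : ℕ, ∀ N ≥ N₀,
      δ * (suppMeasure W νf νf' (γ₀ : GA W) DZf (p ^ (N + n₁)) (γ₀ : GA W)).toReal ≤
        ‖∫ b in DZf, R.chi b * innerFin W R (levelDC W (γ₀ : GA W) (p ^ (N + n₁))) (γ₀ : GA W) νf' b ∂νf‖)
    (hchain : ∀ N : ℕ, ChainInputs W R γ₀ νinf νf νinf' νf' DZf
      ((Setting.ofAdelicData W R μ DG fdG compG compT compT').conv
        (prodFn W finf (ffinMuNat W μ₀ (γ₀ : GA W) (fun n => p ^ (n + n₁)) (p ^ (N + n₁))))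
        (testNat W e (p ^ (N + n₁))))
      (fun x => (c₀ : ℂ) * convInf W μinf finf e x) (levelDC W (γ₀ : GA W) (p ^ (N + n₁)))) :
    ∃ lev : ℕ → ℕ, (∀ n, lev n ≠ 0) ∧
    ∃ ffin f₂ : ℕ → GA W → ℂ, TailFamily' W q g g' eP' eM' (γ₀ : GA W) ffin f₂ ∧
      ∃ E : Finset (Setting.ofAdelicData W R μ DG fdG compG compT compT').Orbit,
        (Setting.ofAdelicData W R μ DG fdG compG compT compT').orbitOf γ₀ ∈ E ∧
        FibreDominatedFrom (Setting.ofAdelicData W R μ DG fdG compG compT compT') R.chi R.chi' E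
          (fun n => (Setting.ofAdelicData W R μ DG fdG compG compT compT').conv
            (prodFn W finf (ffin (lev n))) (f₂ (lev n))) :=
  exists_levelFamily_fibreDominated_of_displays_idx W R μ DG fdG compG compT compT' hRH hc hu hc' hu' q g g' w₀ eP eM
    eP' eM' γ₀ νinf νinf' finf hfinf μ₀ he hequiv p n₁ hp hγ₀ hsep νf νf' DZf C' hC' hratio hv hcount gth hg hR
    (main_term_of_displays'' W R μ DG fdG compG compT compT' hRH γ₀ hreg νinf νf c hc0 hcμ νinf' νf' c' hc0' hcμ' DZf
      hDZf hfd μinf μ₀ c₀ hc₀ hcμ₀ finf e harch p n₁ hp.ne_zero C' hC' hnv hchain)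

end Glue2

end Summit.Ventures.HodgeRepro.Tier4.Line4

end
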